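import Summits.AtomisticToContinuum.Crystallization.Theorems.FrustratedLawDichotomyStrainedPatchConeAnatomy

/-!
# Strained patch — «StiffSector»: the intrinsic pair refinement (N) cut by a HOST SECTOR predicate; the soft sector is pair-blind and FREE

decomp-a2c lens-5 g94 NODE SKETCH (crux `AperiodicFrustratedLawGap`, stmt-AtomisticToContinuum-27623, T-side [CORE-FAR], cut 87C «ConeAnatomy»
(p854143): (D_GB⋆) ⟸ (N) `RefineGB 𝓘₀ 𝓗 ρ ε (1/8) (1/25) (constTol (1/25)) τ T B` ∧ (F) `ShadowsGB …`; lens «finite/base range + asymptotic regime + bridge»).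

THE FINDING «SHUFFLE-94» (memo `decomp-a2c-lens-5/g94/memo/NODE-g94.md`, instrument `g94/num/shuffle94.c`, independent verifier `g94/num/verify94.py`,
witness clusters `g94/num/W94{a,b,c}.json`).  The far host window of record (`FamP = bentFamilyW bends0 (1/8)`: admissible, bent, `1/8`-good centre — NO
density or stiffness clause; `IsHomBall` allows `‖G − 1‖ ≤ 1/4`) contains a SOFT SECTOR — hosts whose short-wave (zone-boundary, period-2) LJ₇ stiffness
`Λ_D(z₀)` is `≲ 0.7` or negative: two thirds of the sampled hosts with nearest-neighbour distance `d ≥ 1.04` (cell minima of `Λ_D` negative in every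
misfit bin there) and everything beyond the diagonal band `(d, η) ≈ (0.90, 0.11) … (1.03, 0.063)` of the regime map (memo §2.3; 2206 window hosts).  On a soft host the per-site FORCE CAP `σ₁ = 8892/7⁷` of `¬ExemptNear … ExRec` (the `s → 0` slope of
`MoveUnstableCore 0 7 s`, cf. `sigmaOne`) admits the period-2 («frozen zone-boundary phonon») modulation `x_n = U X_n ± A ε` with `A` up to
`min(σ₁/Λ_D, A_clean, 1/25)`; its odd host bonds alternate `U p ± δ`, `|δ| = 2A`, so EVERY smooth hull host (isometry ∘ `bends0`-bend ∘ homogeneous ball,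
labels forced by the `1/25` site clause) misses an inner pair touching the centre by `≥ |δ| − (q₂ℓ² + 6q₃ℓ³)` (second difference of the bend; `q₂ = 1/200`,
`q₃ = 1/2000`).  Witness W94c (host `U = (1.0773, 1.0913, 1.1071 | 0.0262, −0.0109, −0.0226)`, `η_host = 0.0609`, L-type point, `A = 0.024`): every
`63/10`-ball site has misfit `0.1052 ∈ (1/20, 1/8]`, clean gap `r₁₂/d = 1.104 < 13/10 < 1.421 = r₁₃/d`, `|f|_LJ₇ = 0.227 σ₁`, cage `λ_min = +1.63`, removal sum
`−1.067 < −0.7018`, finite-move margin `> 0`, LSQ-affine core residual `0.024 > 1/100`; pair deviation `≥ 0.048 − 0.0102 = 0.0378` against the record cones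
read at `ℓ + 0.09`: FZ09-type `0.0314`, FZ62-type `0.0209`, HM62-type `0.0239` — ALL VIOLATED (W94a: `0.0425` vs `0.0311`; W94b: `0.0375` vs `0.0316`).
HENCE (N) — and (D_GB⋆) — over the FULL coarse family `FamP` is FALSE at every table that is sub-kinematic on (hull hosts near) the soft sector; the record's
own classes FZ00/FZ62/FZ09 (`Λ_D = 8.2, 6.3, 2.4`; force-cap amplitude `|δ| ≤ 0.009`) sit in the STIFF sector, where the same construction stays `×3` inside
their cones, and the dense soft corner (`d ≤ 1`, `η ≳ 0.10`; FZ12 `Λ_D = −1.34`) is capped by cleanliness at `|δ| ≈ 0.020–0.024 <` cone + bend allowance.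

THE CUT (by construction, this file; every piece strictly weaker than (N), the soft piece PROVED):
  (N)(table `sectorPair 𝓟 B T`) ⟸ (N|𝓟) `RefineGB (famAnd 𝓘₀ 𝓟) 𝓗 ρ ε η₂ τ₀ T₀ τ T B`   [ANALYTIC · IDEA-NEEDED — the residual, now POSED WITH ITS
                                        NATURAL HYPOTHESIS: the coarse host is 𝓟-stiff; BASIN-87's linear term `σ₁·g`, `g ∼ 1/Λ_D`, is finite exactly here]
                               ∧ (N|¬𝓟) `RefineGB (famAndNot 𝓘₀ 𝓟) 𝓗 … (sectorPair 𝓟 B T)`   [PROVED FREE: `refineGB_famAndNot_free` — the coarse host is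
                                        its own hull host, the pair clause at the site-sum table is the triangle inequality (`chartByG_bond`)]
  seam `refineGB_of_stiffSector` (case split on `𝓟` at the coarse host; `PairLE B (pairSum T)` makes `B ≤ sectorPair 𝓟 B T`).
Downstream nothing changes in shape: (F) `ShadowsGB 𝓗 𝓘 τ (1/25) T (constTol (1/25)) (sectorPair 𝓟 B T) (relConeBy 2 βf sf (1/25))` asks the record
functionals to be KINEMATIC (`βf = 2/25, sf = 0`, `stepBy`) on record hosts shadowing soft hull hosts — their E-cells are pair-blind (large energy margin on
the dilated sector: site surplus `≥ 0.15 ≫ κ_T`; census to price) — and cones stay available on the stiff classes, where they are needed and true.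
The typed KILL TARGET for the census («SHUFFLE-94-CERT»): `ConeWitness … z c` for W94c in interval arithmetic ⟹ `not_refineGB_of_coneWitness`.

RECOMMENDED 𝓟 (numerical, memo §2.3): `Λ_D(z₀) ≥ Λ₀` with `Λ₀ ≈ 1` (short-wave LJ₇ stiffness of the host's homogeneous part), or the cruder DENSITY–MISFIT
DOOR `d_nn(z₀, c₀) ≤ 0.96 ∧ η(z₀) ≤ 0.09`, which contains the record classes FZ00/FZ62/FZ09 and on the sample implies `Λ_D ≥ 2.1` (`d ≤ 1 ∧ η ≤ 0.07`:
`≥ 1.65`; `d ≤ 1 ∧ η ≤ 1/10` does NOT suffice: cell minimum `−0.12`).  A typed spectral predicate is an ask (hand-2); this file keeps `𝓟` abstract, so it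
composes with `stepBy`/`tubeFloorGB_relConeBy_step` of the record.
[formal bookkeeping] 0 sorry · no new axioms · no cite tokens · no instances / notation.
-/

namespace Summit.AtomisticToContinuum.Crystallization.Theorems.FrustratedLawDichotomyStrainedPatchStiffSector

open scoped BigOperators Classical
open Summit.AtomisticToContinuum.Crystallization.Theorems.ChargedEnergyGapNegative (eStar E3)
open Summit.AtomisticToContinuum.Crystallization.Theorems.FrustratedLawDichotomyMotifLemmas (GoodAtScale)
open Summit.AtomisticToContinuum.Crystallization.Theorems.FrustratedLawDichotomyStrainedPatchHomSplit
open Summit.AtomisticToContinuum.Crystallization.Theorems.FrustratedLawDichotomyStrainedPatchCleanCollar (CleanBall)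
open Summit.AtomisticToContinuum.Crystallization.Theorems.FrustratedLawDichotomyStrainedPatchPhaseCut (MonoPhaseBall)
open Summit.AtomisticToContinuum.Crystallization.Theorems.FrustratedLawDichotomyStrainedPatchCoreTube (NearHomIsoAt CoreOffTubeFloor)
open Summit.AtomisticToContinuum.Crystallization.Theorems.FrustratedLawDichotomyStrainedPatchChartFamilies (ChartBy FamilyLE)
open Summit.AtomisticToContinuum.Crystallization.Theorems.FrustratedLawDichotomyStrainedPatchQuantSlaving (ChartFam SlackTab)
open Summit.AtomisticToContinuum.Crystallization.Theorems.FrustratedLawDichotomyStrainedPatchGradedTube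
open Summit.AtomisticToContinuum.Crystallization.Theorems.FrustratedLawDichotomyStrainedPatchCoverBridge
open Summit.AtomisticToContinuum.Crystallization.Theorems.FrustratedLawDichotomyStrainedPatchPairTube
open Summit.AtomisticToContinuum.Crystallization.Theorems.FrustratedLawDichotomyStrainedPatchConeAnatomy

/-! ## §0. Sector families and the sector pair table -/

/-- (piece) [route statement · this cell; NOT a literature fact] The coarse family restricted to the sector `𝓟` (e.g. STIFF hosts). -/
def famAnd (𝓘 𝓟 : ChartFam) : ChartFam := fun M₀ z₀ c₀ => 𝓘 M₀ z₀ c₀ ∧ 𝓟 M₀ z₀ c₀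

/-- (piece) [route statement · this cell; NOT a literature fact] The coarse family restricted to the complement of `𝓟` (e.g. SOFT hosts). -/
def famAndNot (𝓘 𝓟 : ChartFam) : ChartFam := fun M₀ z₀ c₀ => 𝓘 M₀ z₀ c₀ ∧ ¬𝓟 M₀ z₀ c₀

/-- ★ `sectorPair 𝓟 B T` — the host-read pair table: the cone `B` on `𝓟`-hosts, the pair-blind site sum `pairSum T` (kinematic) off `𝓟`. -/
noncomputable def sectorPair (𝓟 : ChartFam) (B : PairTab) (T : SlackTab) : PairTab :=
  fun M₀ z₀ c₀ a b => if 𝓟 M₀ z₀ c₀ then B M₀ z₀ c₀ a b else pairSum T M₀ z₀ c₀ a b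

section Tables

variable {𝓘 𝓟 : ChartFam} {B : PairTab} {T : SlackTab} {M₀ : ℕ} {z₀ : Fin M₀ → E3} {c₀ : Fin M₀}

/-- [formal bookkeeping] -/
theorem famAnd_le : FamilyLE (famAnd 𝓘 𝓟) 𝓘 := fun _ _ _ h => h.1

/-- [formal bookkeeping] -/
theorem famAndNot_le : FamilyLE (famAndNot 𝓘 𝓟) 𝓘 := fun _ _ _ h => h.1

/-- [formal bookkeeping] -/
theorem sectorPair_of_pos (h : 𝓟 M₀ z₀ c₀) (a b : Fin M₀) : sectorPair 𝓟 B T M₀ z₀ c₀ a b = B M₀ z₀ c₀ a b := by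
  simp [sectorPair, h]

/-- [formal bookkeeping] -/
theorem sectorPair_of_neg (h : ¬𝓟 M₀ z₀ c₀) (a b : Fin M₀) : sectorPair 𝓟 B T M₀ z₀ c₀ a b = pairSum T M₀ z₀ c₀ a b := by
  simp [sectorPair, h]

/-- A capped cone (`B ≤ pairSum T`, true for `relConeBy` at `T = constTol τ₀` by its cap) lies below its sector table. [formal bookkeeping] -/
theorem pairLE_sectorPair (hBT : PairLE B (pairSum T)) : PairLE B (sectorPair 𝓟 B T) := by
  intro M₀ z₀ c₀ a b
  by_cases h : 𝓟 M₀ z₀ c₀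
  · rw [sectorPair_of_pos h]
  · rw [sectorPair_of_neg h]; exact hBT M₀ z₀ c₀ a b

/-- … and the sector table lies below the site sum when the cone does. [formal bookkeeping] -/
theorem sectorPair_le_pairSum (hBT : PairLE B (pairSum T)) : PairLE (sectorPair 𝓟 B T) (pairSum T) := by
  intro M₀ z₀ c₀ a b
  by_cases h : 𝓟 M₀ z₀ c₀
  · rw [sectorPair_of_pos h]; exact hBT M₀ z₀ c₀ a b
  · rw [sectorPair_of_neg h]

end Tables

/-! ## §1. The soft sector is free; the sector cut -/

section Cut

variable {𝓘₀ 𝓗 𝓟 : ChartFam} {ρ ε η₂ τ₀ τ : ℝ} {T₀ T : SlackTab} {B : PairTab}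
  {M : ℕ} {z : Fin M → E3} {c : Fin M} {M₀ : ℕ} {z₀ : Fin M₀ → E3} {c₀ : Fin M₀} {e : Fin M → Fin M₀}

/-- Re-read a graded chart in another family containing the SAME host. [formal bookkeeping] -/
theorem chartByG_refamily {𝓘 𝓘' : ChartFam} (h : ChartByG 𝓘 τ T z c z₀ c₀ e) (h' : 𝓘' M₀ z₀ c₀) : ChartByG 𝓘' τ T z c z₀ c₀ e :=
  ⟨⟨h', h.1.2⟩, h.2⟩

/-- The host of a graded chart is a member of the family. [formal bookkeeping] -/
theorem chartByG_mem {𝓘 : ChartFam} (h : ChartByG 𝓘 τ T z c z₀ c₀ e) : 𝓘 M₀ z₀ c₀ := h.1.1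

/-- A graded chart by a `¬𝓟`-host IS a GB-chart at the sector table (pair clause = triangle inequality, `chartByG_bond`). [folklore] -/
theorem chartByGB_sectorPair_of_neg {𝓘 : ChartFam} (h : ChartByG 𝓘 τ T z c z₀ c₀ e) (hn : ¬𝓟 M₀ z₀ c₀) :
    ChartByGB 𝓘 τ T (sectorPair 𝓟 B T) z c z₀ c₀ e := by
  refine ⟨h, fun a b ha hb => ?_⟩
  rw [sectorPair_of_neg hn]
  exact (chartByGB_of_chartByG_of_sumLE h (PairLE.refl _)).2 a b ha hb

/-- ★ **THE SOFT SECTOR IS FREE.**  If the soft coarse hosts are hull hosts and the hull data dominate the coarse data, (N) restricted to clusters charted by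
SOFT coarse hosts holds at the sector table — the coarse host is its own refinement. [folklore] -/
theorem refineGB_famAndNot_free (h𝓗 : FamilyLE (famAndNot 𝓘₀ 𝓟) 𝓗) (hτ : τ₀ ≤ τ) (hT : TolLE T₀ T) :
    RefineGB (famAndNot 𝓘₀ 𝓟) 𝓗 ρ ε η₂ τ₀ T₀ τ T (sectorPair 𝓟 B T) := by
  intro M z c M₀ z₀ c₀ e _ _ _ _ _ hch
  have hn : ¬𝓟 M₀ z₀ c₀ := (chartByG_mem hch).2
  have h₁ : ChartByG 𝓗 τ T z c z₀ c₀ e := ((chartByG_mono_scalar hch hτ).mono_tol hT).mono_family h𝓗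
  refine ⟨LinearIsometryEquiv.refl ℝ E3, M₀, z₀, c₀, e, ?_⟩
  have hcomp : ⇑(LinearIsometryEquiv.refl ℝ E3) ∘ z = z := by
    funext a
    simp
  rw [hcomp]
  exact chartByGB_sectorPair_of_neg h₁ hn

/-- ★★ **THE SECTOR CUT: (N|𝓟) ⟹ (N) at the sector table.**  Clusters charted by a STIFF coarse host are refined by hypothesis (at the cone `B`, hence at
`sectorPair 𝓟 B T ≥ B`); clusters charted by a SOFT coarse host are refined for free. [folklore] -/
theorem refineGB_of_stiffSector (hN : RefineGB (famAnd 𝓘₀ 𝓟) 𝓗 ρ ε η₂ τ₀ T₀ τ T B) (h𝓗 : FamilyLE (famAndNot 𝓘₀ 𝓟) 𝓗) (hτ : τ₀ ≤ τ)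
    (hT : TolLE T₀ T) (hBT : PairLE B (pairSum T)) : RefineGB 𝓘₀ 𝓗 ρ ε η₂ τ₀ T₀ τ T (sectorPair 𝓟 B T) := by
  intro M z c M₀ z₀ c₀ e hz hcl hm hn hg hch
  by_cases hP : 𝓟 M₀ z₀ c₀
  · obtain ⟨R, M₁, z₁, c₁, e₁, h₁⟩ := hN M z c M₀ z₀ c₀ e hz hcl hm hn hg (chartByG_refamily hch ⟨chartByG_mem hch, hP⟩)
    exact ⟨R, M₁, z₁, c₁, e₁, h₁.weaken (fun _ _ _ h => h) (fun _ _ _ _ => le_rfl) (pairLE_sectorPair hBT) le_rfl⟩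
  · exact refineGB_famAndNot_free h𝓗 hτ hT M z c M₀ z₀ c₀ e hz hcl hm hn hg (chartByG_refamily hch ⟨chartByG_mem hch, hP⟩)

/-- EXACTNESS: (N) over the full coarse family gives (N|𝓟) back (fewer clusters). [formal bookkeeping] -/
theorem refineGB_famAnd_of_refineGB (h : RefineGB 𝓘₀ 𝓗 ρ ε η₂ τ₀ T₀ τ T B) : RefineGB (famAnd 𝓘₀ 𝓟) 𝓗 ρ ε η₂ τ₀ T₀ τ T B :=
  fun M z c M₀ z₀ c₀ e hz hcl hm hn hg hch => h M z c M₀ z₀ c₀ e hz hcl hm hn hg (hch.mono_family famAnd_le)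

/-- ★ THE RECORD READING: with the seam of 87C, (N|𝓟) ∧ (F at the sector table) ⟹ (D_GB⋆) `RefineGBRecByAt 𝓘₀ 𝓘 ρ ε βf sf`. [folklore] -/
theorem refineGBRecByAt_of_stiffSector_of_shadows {𝓘 : ChartFam} {βf sf : (M₀ : ℕ) → (Fin M₀ → E3) → Fin M₀ → ℝ}
    (hN : RefineGB (famAnd 𝓘₀ 𝓟) 𝓗 ρ ε (1 / 8) (1 / 25) (constTol (1 / 25)) τ T B) (h𝓗 : FamilyLE (famAndNot 𝓘₀ 𝓟) 𝓗) (hτ : 1 / 25 ≤ τ)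
    (hT : TolLE (constTol (1 / 25)) T) (hBT : PairLE B (pairSum T))
    (hSh : ShadowsGB 𝓗 𝓘 τ (1 / 25) T (constTol (1 / 25)) (sectorPair 𝓟 B T) (relConeBy 2 βf sf (1 / 25))) :
    RefineGBRecByAt 𝓘₀ 𝓘 ρ ε βf sf :=
  RefineGB.shadow (refineGB_of_stiffSector hN h𝓗 hτ hT hBT) hSh

end Cut

/-! ## §2. The typed kill target for the soft sector -/

section Witness

variable {𝓘₀ 𝓗 : ChartFam} {ρ ε η₂ τ₀ τ : ℝ} {T₀ T : SlackTab} {B : PairTab}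

/-- (piece) [route statement · this cell; NOT a literature fact] **`ConeWitness … z c`** — a far-class cluster, coarse-charted by `𝓘₀`, that NO hull host GB-charts at `(τ, T, B)` in any isometric position: the
census certifies this for W94c («SHUFFLE-94-CERT», interval arithmetic over the `63/10`-ball; the pair clause by the bend second-difference bound). -/
def ConeWitness (𝓘₀ 𝓗 : ChartFam) (ρ ε η₂ τ₀ : ℝ) (T₀ : SlackTab) (τ : ℝ) (T : SlackTab) (B : PairTab) {M : ℕ} (z : Fin M → E3) (c : Fin M) : Prop :=
  Admissible M z c ∧ CleanBall (63 / 10) z c ∧ MonoPhaseBall (63 / 10) z c ∧ ¬NearHomIsoAt ρ ε z c ∧ GoodAtScale η₂ (3 / 2) z c ∧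
    (∃ (M₀ : ℕ) (z₀ : Fin M₀ → E3) (c₀ : Fin M₀) (e : Fin M → Fin M₀), ChartByG 𝓘₀ τ₀ T₀ z c z₀ c₀ e) ∧
    ∀ (R : E3 ≃ₗᵢ[ℝ] E3) (M₁ : ℕ) (z₁ : Fin M₁ → E3) (c₁ : Fin M₁) (e₁ : Fin M → Fin M₁), ¬ChartByGB 𝓗 τ T B (⇑R ∘ z) c z₁ c₁ e₁

/-- ★ A cone witness refutes (N) at that table. [formal bookkeeping] -/
theorem not_refineGB_of_coneWitness {M : ℕ} {z : Fin M → E3} {c : Fin M} (h : ConeWitness 𝓘₀ 𝓗 ρ ε η₂ τ₀ T₀ τ T B z c) :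
    ¬RefineGB 𝓘₀ 𝓗 ρ ε η₂ τ₀ T₀ τ T B := by
  obtain ⟨hz, hcl, hm, hn, hg, ⟨M₀, z₀, c₀, e, hch⟩, hno⟩ := h
  intro hN
  obtain ⟨R, M₁, z₁, c₁, e₁, h₁⟩ := hN M z c M₀ z₀ c₀ e hz hcl hm hn hg hch
  exact hno R M₁ z₁ c₁ e₁ h₁

/-- … and a witness charted by a `𝓟`-host refutes the restricted statement (N|𝓟) too; a witness charted by a SOFT host says nothing about (N|𝓟) — which is
the point of the cut. [formal bookkeeping] -/
theorem not_refineGB_famAnd_of_coneWitness {𝓟 : ChartFam} {M : ℕ} {z : Fin M → E3} {c : Fin M}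
    (h : ConeWitness (famAnd 𝓘₀ 𝓟) 𝓗 ρ ε η₂ τ₀ T₀ τ T B z c) : ¬RefineGB (famAnd 𝓘₀ 𝓟) 𝓗 ρ ε η₂ τ₀ T₀ τ T B :=
  not_refineGB_of_coneWitness h

end Witness

end Summit.AtomisticToContinuum.Crystallization.Theorems.FrustratedLawDichotomyStrainedPatchStiffSector
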